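import Literature.NumberTheory.Automorphic.ArchEndoscopicChartMeasures       -- ★ p849670 LH2-p04 (g3) (T-MEAS): `chartTorusH`, `chartQuotientMeasureH`, `chartOrbH`; brings ★ atlas `endoTorus`, `endoBlock`, `hypBlockGL`
import Literature.NumberTheory.Automorphic.ArchCartanCoordinates            -- ★ p849533 LH3-p01 (g3) (COORD): `RegS`, `isOpen_regS`
import Literature.NumberTheory.Rogawski1990.ArchHyperbolicOrbitProperTwo     -- FILE 1 (F0P3a-p09 (g5)): the split Cartan of `U(Φ₂)(ℂ)` is uniformly proper (column balancing)
import Literature.NumberTheory.Rogawski1990.ArchOrbitalIntegralContinuityPlaces -- ★ p849620 LH2-p04 (g3): per-place (HYP) providers, `uniformlyProper_circleDiagonal`; brings ★ `isCompact_setOf_exists_conj_circleDiagonal_mem`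
import Literature.NumberTheory.Automorphic.UnitaryGroupArchimedean             -- ★ `isCompact_arch_cm` (definite factors are compact)
import HarnessLib

/-!
# The chart orbital functionals `chartOrbH` of `H_∞ = U(Φ₂)(L⁺ ⊗ ℝ) × U(Φ₁)(L⁺ ⊗ ℝ)` are CONTINUOUS on the regular set `RegS S` of EVERY Cartan chart
# («(W1-cont-H)» FILE 2: Rogawski 1990 §3.1, §4.9, §8.3; Shelstad 1979 §4; Deitmar–Echterhoff 2014 Lemma 9.3.3)

Topic `NumberTheory/Automorphic`; namespace `Literature.NumberTheory.Automorphic.UnitaryGroup`.  THEOREMS ONLY (no `def`, no instance, no notation, no axiom, no named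
fact, no `sorry`).  Cell `pub/hodgecm-mathlib`, crux H413 (`stmt-HodgeConjecture-24833`), F0∕P3c line LH3 (closer stub `stub_N9`, DIRECT ROAD «Transf»); the board item
«(W1-cont-H) `continuousOn_chartOrbH_regS`» of LH3-plan (g2)'s SEAM RULING 2026-09-02T05:53:17Z (b) (count-neutral hardening); seat F0P3a-p09 (g5).

THE MATHEMATICS.  `chartOrbH νH S fH c = dt_S(B_S) · ∫_{H_∞ ⧸ T_S} fH(y · endoTorus S c · y⁻¹) d(dνH ∕ dt_S)(ȳ)` (★ (T-MEAS)) is continuous at every `c ∈ RegS S` for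
`fH ∈ C_c(H_∞)` and `νH` finite on compacts, right invariant: by the generic engine ★ `continuousOn_integral_descConj_of_uniformlyProper` it suffices that the chart
`c ↦ endoTorus S c` be UNIFORMLY PROPER MODULO `T_S` on `RegS S` — for compact `K ⊆ RegS S` and compact `C ⊆ H_∞`, the cosets `y T_S` with `y · endoTorus S c · y⁻¹ ∈ C`
for some `c ∈ K` lie in one compact subset of `H_∞ ⧸ T_S` (§4 `uniformlyProper_endoTorus`).  Since `H_∞ = A × B` with `B = U(Φ₁)_∞` COMPACT and `A = U(Φ₂)_∞ ≅ Π_w U(Φ₂)(ℂ)`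
(★ `archPiEquivCM`), and since the range of the chart (hence `T_S`) contains `(endoTorus S c′, 1)` for every `c′` with vanishing `U(Φ₁)`-angles, it suffices to find, place
by place, a compact `B_w ⊆ U(Φ₂)(ℂ)` containing a TORUS TRANSLATE `y_w · endoBlock S c′ w` of every `y_w` conjugating some `endoBlock S c w`, `c ∈ K`, into a compact:
* §1 SPLIT place `w ∈ S` (`endoBlock S c w = diag(e^{x+iθ}, e^{−x+iθ})`, regular iff `x ≠ 0`): ★ FILE 1 `exists_isCompact_forall_exists_mul_diag_mem₂` (column balancing) gives
  `y_w · diag(r, r⁻¹) ∈ B_w` with `r > 0`, and `diag(r, r⁻¹) = endoBlock S c′ w` for `c′ w = (log r, 0, 0)` — `exists_isCompact_forall_exists_mul_endoBlock_mem_of_mem`.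
* §2 COMPACT place `w ∉ S` (`endoBlock S c w = P·diag(e^{ic₀}, e^{ic₂})·P⁻¹`, regular iff `e^{ic₀} ≠ e^{ic₂}`): the conjugating set itself is compact — ★
  `isCompact_setOf_exists_conj_circleDiagonal_mem` (Harish-Chandra, compact Cartan) transported through the Cayley frame `g ↦ P g P⁻¹`,
  `U(diag(2,−2))(ℂ) ≃ₜ* U(Φ₂)(ℂ)` (★ `unitaryGroupOfFormCongrOfEq`, ★ `formCongr_cayleyTwo`) — `isCompact_setOf_exists_conj_endoBlock_mem_of_not_mem` (translate `c′ w = 0`).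
* §3 the places assembly on `A` (`exists_isCompact_forall_exists_mul_endoTorus_fst_mem`: `B_A := archPiEquivCM⁻¹(Π_w B_w)`), §4 (HYP) on `H_∞` modulo `T_S`
  (`uniformlyProper_endoTorus`: `𝒦 := (B_A × B) T_S`) and THE HEAD **`continuousOn_chartOrbH_regS`**.
HONEST LABEL: HC_CM is proved only modulo the 7 printed citations (2 remaining named inputs: hLiu418 = `stmt-HodgeConjecture-24832`, h413 = `stmt-HodgeConjecture-24833`)
until rung 0 closes; this file is count-neutral (M1)∕(I₁)-C⁰ kit on MIXED Cartans (the all-compact case is ★ (CONT-H-ell) in Haar currency) and pays no organ.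

## References
* [Rogawski1990] J. D. Rogawski, *Automorphic Representations of Unitary Groups in Three Variables*, Ann. of Math. Stud. 123 (1990), §3.1 p. 19, §3.6 p. 31 (Cartan
  subgroups), §4.3 p. 43 (`G_∞ = Π_w G_w`), §4.9 p. 54 (`H = U(2) × U(1)`, `U(1,1) × U(1)`), §8.2 p. 122, §8.3 p. 122 (orbital integrals as functions on `T_reg`).
* [Shelstad1979] D. Shelstad, *Characters and inner forms of a quasi-split group over ℝ*, Compositio Math. 39 (1979), §4 pp. 22–23 (orbital integrals on `T_reg`, any `dt`).
* [DeitmarEchterhoff2014] A. Deitmar, S. Echterhoff, *Principles of Harmonic Analysis*, 2nd ed. (2014), Lemma 9.3.3, Thm. 1.5.3.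
* [Folland1995] G. B. Folland, *A Course in Abstract Harmonic Analysis* (1995), §2.6 Thm. 2.49 (quotients of products).
-/

set_option autoImplicit false

noncomputable section

open MeasureTheory MeasureTheory.Measure NumberField NumberField.InfinitePlace Matrix Complex Topology Set
open Literature.MeasureTheory.Group Literature.NumberTheory.Rogawski1990 Literature.NumberTheory.Automorphic.ArchCartan
open scoped MatrixGroups Matrix

namespace Literature.NumberTheory.Automorphic.UnitaryGroup

/-! ## §1 Split place: a torus translate of every conjugating element lies in one compact set -/

section Split

variable (L : Type) [Field L] (w : {w : InfinitePlace L // IsComplex w})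

/-- The matrix of the split block `hypBlockGL x θ` in the shape `diag(a, ā⁻¹)` of ★ FILE 1 (`a = e^{x+iθ}`, `ā⁻¹ = e^{−x+iθ}`). [cite: Rogawski1990, §3.6 p. 31] -/
theorem coe_hypBlockGL_eq_diagHyp (x θ : ℝ) :
    ((hypBlockGL x θ : GL (Fin 2) ℂ) : Matrix (Fin 2) (Fin 2) ℂ) =
      !![Complex.exp ((x : ℂ) + (θ : ℂ) * I), 0; 0, (star (Complex.exp ((x : ℂ) + (θ : ℂ) * I)))⁻¹] := by
  rw [coe_hypBlockGL]
  congr 1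
  funext i
  fin_cases i
  · rfl
  · simp only [Fin.mk_one, Matrix.cons_val_one]
    congr 1
    funext j
    fin_cases j
    · rfl
    · simp only [Fin.mk_one, Matrix.cons_val_one]
      rw [Complex.star_def, ← Complex.exp_conj, map_add, map_mul, Complex.conj_ofReal, Complex.conj_ofReal, Complex.conj_I, ← Complex.exp_neg]
      congr 1
      ring

/-- `‖e^{x+iθ}‖ = e^x`, so the split block is regular (`‖a‖ ≠ 1`) iff `x ≠ 0`. [cite: Rogawski1990, §3.6 p. 31] -/
theorem norm_exp_coord_ne_one_iff (x θ : ℝ) : ‖Complex.exp ((x : ℂ) + (θ : ℂ) * I)‖ ≠ 1 ↔ x ≠ 0 := by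
  rw [Complex.norm_exp, Complex.add_re, Complex.ofReal_re, Complex.re_ofReal_mul, Complex.I_re, mul_zero, add_zero]
  exact not_congr (Real.exp_eq_one_iff x)

/-- `diag(r, r⁻¹) = hypBlockGL (log r) 0` for `r > 0`: the real torus translates of ★ FILE 1 are chart points. [cite: Rogawski1990, §3.6 p. 31] -/
theorem coe_hypBlockGL_log (r : ℝ) (hr : 0 < r) :
    ((hypBlockGL (Real.log r) 0 : GL (Fin 2) ℂ) : Matrix (Fin 2) (Fin 2) ℂ) = !![(r : ℂ), 0; 0, ((r⁻¹ : ℝ) : ℂ)] := by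
  rw [coe_hypBlockGL, Complex.ofReal_zero, zero_mul, add_zero, add_zero, ← Complex.ofReal_neg, ← Complex.ofReal_exp, ← Complex.ofReal_exp, Real.exp_log hr,
    Real.exp_neg, Real.exp_log hr]

/-- **SPLIT PLACE `w ∈ S`: ONE COMPACT `B_w ⊆ U(Φ₂)(ℂ)_w` CONTAINS A TORUS TRANSLATE `y · endoBlock S c′ w` OF EVERY `y` CONJUGATING SOME `endoBlock S c w`, `c ∈ K`, INTO `C`**
(`K` compact with `c w 0 ≠ 0` on it, `C` compact; `c′ w = (x′, 0, 0)`).  ★ FILE 1 `exists_isCompact_forall_exists_mul_diag_mem₂` on the chart `(x, θ) ↦ hypBlockGL x θ`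
composed with `c ↦ (c w 0, c w 2)`. [cite: Rogawski1990, §3.1 p. 19; §8.3 p. 122] [cite: Shelstad1979, §4 p. 22] [cite: DeitmarEchterhoff2014, Lemma 9.3.3] -/
theorem exists_isCompact_forall_exists_mul_endoBlock_mem_of_mem (S : Finset {w : InfinitePlace L // IsComplex w}) (hw : w ∈ S)
    {K : Set ({w : InfinitePlace L // IsComplex w} → Fin 3 → ℝ)} (hK : IsCompact K) (hK0 : ∀ c ∈ K, c w 0 ≠ 0)
    {C : Set ↥(archLocal L 2 (Matrix.of fun i j : Fin 2 => if i.val + j.val + 1 = 2 then (1 : L) else 0) w)} (hC : IsCompact C) :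
    ∃ B : Set ↥(archLocal L 2 (Matrix.of fun i j : Fin 2 => if i.val + j.val + 1 = 2 then (1 : L) else 0) w), IsCompact B ∧
      ∀ c ∈ K, ∀ y : ↥(archLocal L 2 (Matrix.of fun i j : Fin 2 => if i.val + j.val + 1 = 2 then (1 : L) else 0) w),
        y * endoBlock L S c w * y⁻¹ ∈ C → ∃ x' : ℝ, y * endoBlock L S (fun _ => ![x', 0, 0]) w ∈ B := by
  -- the chart `(x, θ) ↦ hypBlockGL x θ` in the shape of FILE 1
  have hJ : (Matrix.of fun i j : Fin 2 => if i.val + j.val + 1 = 2 then (1 : L) else 0).map w.1.embedding =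
      Matrix.of fun i j : Fin 2 => if i.val + j.val + 1 = 2 then (1 : ℂ) else 0 := Literature.NumberTheory.Rogawski1990.antidiagOne_map w.1.embedding 2
  have hc : Continuous fun p : ℝ × ℝ =>
      (⟨hypBlockGL p.1 p.2, hypBlockGL_mem_archLocal L w p.1 p.2⟩ : ↥(archLocal L 2 (Matrix.of fun i j : Fin 2 => if i.val + j.val + 1 = 2 then (1 : L) else 0) w)) :=
    continuous_hypBlockGL.subtype_mk _
  have hK' : IsCompact ((fun c : {w : InfinitePlace L // IsComplex w} → Fin 3 → ℝ => (c w 0, c w 2)) '' K) :=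
    hK.image (((continuous_apply 0).comp (continuous_apply w)).prodMk ((continuous_apply 2).comp (continuous_apply w)))
  have hK'S : (fun c : {w : InfinitePlace L // IsComplex w} → Fin 3 → ℝ => (c w 0, c w 2)) '' K ⊆
      {p : ℝ × ℝ | ‖Complex.exp ((p.1 : ℂ) + (p.2 : ℂ) * I)‖ ≠ 1} := by
    rintro _ ⟨c, hc, rfl⟩
    exact (norm_exp_coord_ne_one_iff _ _).2 (hK0 c hc)
  obtain ⟨B, hB, hmem⟩ := exists_isCompact_forall_exists_mul_diag_mem₂ hJ hc (fun p : ℝ × ℝ => Complex.exp ((p.1 : ℂ) + (p.2 : ℂ) * I))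
    (fun p => coe_hypBlockGL_eq_diagHyp p.1 p.2) _ hK'S hK' C hC
  refine ⟨B, hB, fun c hcK y hy => ?_⟩
  have hblk : endoBlock L S c w = ⟨hypBlockGL (c w 0) (c w 2), hypBlockGL_mem_archLocal L w (c w 0) (c w 2)⟩ := by
    unfold endoBlock; rw [if_pos hw]
  obtain ⟨r, hr, hyτ⟩ := hmem (c w 0, c w 2) ⟨c, hcK, rfl⟩ y (by rwa [hblk] at hy)
  refine ⟨Real.log r, hyτ (endoBlock L S (fun _ => ![Real.log r, 0, 0]) w) ?_⟩
  have hblk' : endoBlock L S (fun _ => ![Real.log r, 0, 0]) w =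
      ⟨hypBlockGL (Real.log r) 0, hypBlockGL_mem_archLocal L w (Real.log r) 0⟩ := by
    unfold endoBlock; rw [if_pos hw]; rfl
  rw [hblk']
  exact coe_hypBlockGL_log r hr

end Split


/-! ## §2 Compact place: the conjugating set itself is compact (Cayley transport of the diagonal-frame lemma) -/

section CompactPlace

variable (L : Type) [Field L] [NumberField L] (w : {w : InfinitePlace L // IsComplex w})

/-- The Cayley congruent of `σ_w Φ₂` is `σ_w diag(2, −2)` (★ `formCongr_cayleyTwo`, `σ_w 2 = 2`). [cite: Rogawski1990, §8.2 p. 122; §4.9 p. 54] -/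
theorem formCongr_cayleyTwo_eq_map_diagonal :
    formCongr (starRingEnd ℂ) (Matrix.GeneralLinearGroup.mkOfDetNeZero !![(1 : ℂ), 1; 1, -1] det_cayleyTwo_ne_zero)
        ((Matrix.of fun i j : Fin 2 => if i.val + j.val + 1 = 2 then (1 : L) else 0).map w.1.embedding) =
      (Matrix.diagonal ![(2 : L), -2]).map w.1.embedding := by
  rw [formCongr_cayleyTwo, Matrix.diagonal_map (map_zero _)]
  congr 1
  funext i
  fin_cases i
  · exact (map_ofNat w.1.embedding 2).symm
  · show (-2 : ℂ) = w.1.embedding (-2)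
    rw [map_neg, map_ofNat]

/-- A pair of DISTINCT circle points is an injective `Fin 2 → S¹`. [folklore] -/
private theorem injective_vecCons_two_of_ne {a b : Circle} (h : a ≠ b) : Function.Injective ![a, b] := by
  intro i j hij
  fin_cases i <;> fin_cases j
  · rfl
  · exact absurd hij h
  · exact absurd hij.symm h
  · rfl

/-- **COMPACT PLACE `w ∉ S`: THE SET OF `y ∈ U(Φ₂)(ℂ)_w` CONJUGATING SOME `endoBlock S c w`, `c ∈ K` (regular: `e^{ic_w0} ≠ e^{ic_w2}`), INTO A COMPACT `C` IS COMPACT**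
(Harish-Chandra; compact Cartan).  ★ `isCompact_setOf_exists_conj_circleDiagonal_mem` (diagonal frame `U(diag(2,−2))(ℂ)`, any signature) transported through the Cayley
frame `g ↦ P g P⁻¹` (★ `unitaryGroupOfFormCongrOfEq`): `endoBlock S c w = P·diag(e^{ic_w0}, e^{ic_w2})·P⁻¹`. [cite: Rogawski1990, §8.2 p. 122; §8.3 p. 122; §3.1 p. 19]
[cite: DeitmarEchterhoff2014, Lemma 9.3.3] -/
theorem isCompact_setOf_exists_conj_endoBlock_mem_of_not_mem (S : Finset {w : InfinitePlace L // IsComplex w}) (hw : w ∉ S)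
    {K : Set ({w : InfinitePlace L // IsComplex w} → Fin 3 → ℝ)} (hK : IsCompact K) (hKreg : ∀ c ∈ K, Circle.exp (c w 0) ≠ Circle.exp (c w 2))
    {C : Set ↥(archLocal L 2 (Matrix.of fun i j : Fin 2 => if i.val + j.val + 1 = 2 then (1 : L) else 0) w)} (hC : IsCompact C) :
    IsCompact {y : ↥(archLocal L 2 (Matrix.of fun i j : Fin 2 => if i.val + j.val + 1 = 2 then (1 : L) else 0) w) |
      ∃ c ∈ K, y * endoBlock L S c w * y⁻¹ ∈ C} := by
  have hα : ∀ i, (![(2 : L), -2]) i ≠ 0 := by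
    intro i; fin_cases i <;> simp
  -- the Cayley frame `e : U(σ_w diag(2,−2))(ℂ) ≃ₜ* U(σ_w Φ₂)(ℂ)`, `e g = P g P⁻¹` (kept opaque: only the formula is used)
  obtain ⟨e, he⟩ : ∃ e : ↥(archLocal L 2 (Matrix.diagonal ![(2 : L), -2]) w) ≃ₜ*
      ↥(archLocal L 2 (Matrix.of fun i j : Fin 2 => if i.val + j.val + 1 = 2 then (1 : L) else 0) w),
      ∀ g, ((e g : ↥(archLocal L 2 (Matrix.of fun i j : Fin 2 => if i.val + j.val + 1 = 2 then (1 : L) else 0) w)) : GL (Fin 2) ℂ) =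
        Matrix.GeneralLinearGroup.mkOfDetNeZero !![(1 : ℂ), 1; 1, -1] det_cayleyTwo_ne_zero * (g : GL (Fin 2) ℂ) *
          (Matrix.GeneralLinearGroup.mkOfDetNeZero !![(1 : ℂ), 1; 1, -1] det_cayleyTwo_ne_zero)⁻¹ :=
    ⟨unitaryGroupOfFormCongrOfEq (starRingEnd ℂ) (Matrix.GeneralLinearGroup.mkOfDetNeZero !![(1 : ℂ), 1; 1, -1] det_cayleyTwo_ne_zero) _ _
      (formCongr_cayleyTwo_eq_map_diagonal L w), fun _ => rfl⟩
  -- the angle set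
  have hKz : IsCompact ((fun c : {w : InfinitePlace L // IsComplex w} → Fin 3 → ℝ => ![Circle.exp (c w 0), Circle.exp (c w 2)]) '' K) := by
    refine hK.image ?_
    refine continuous_pi fun i => ?_
    fin_cases i
    · exact Circle.exp.continuous.comp ((continuous_apply 0).comp (continuous_apply w))
    · exact Circle.exp.continuous.comp ((continuous_apply 2).comp (continuous_apply w))
  have hKzreg : (fun c : {w : InfinitePlace L // IsComplex w} → Fin 3 → ℝ => ![Circle.exp (c w 0), Circle.exp (c w 2)]) '' K ⊆ {z | Function.Injective z} := by
    rintro _ ⟨c, hc, rfl⟩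
    exact injective_vecCons_two_of_ne (hKreg c hc)
  have hC' : IsCompact (e ⁻¹' C) := e.toHomeomorph.isCompact_preimage.2 hC
  have hcpt := isCompact_setOf_exists_conj_circleDiagonal_mem L 2 ![(2 : L), -2] w hα hKz hKzreg hC'
  -- `e (diag z) = P·diag z·P⁻¹ = endoBlock S c w`
  have heblk : ∀ c : {w : InfinitePlace L // IsComplex w} → Fin 3 → ℝ,
      e ⟨circleDiagonal 2 ![Circle.exp (c w 0), Circle.exp (c w 2)], circleDiagonal_mem_archLocal_diagonal L 2 ![(2 : L), -2] w _⟩ = endoBlock L S c w := by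
    intro c
    apply Subtype.ext
    rw [he]
    unfold endoBlock
    rw [if_neg hw]
  -- our set is the `e`-image of the diagonal-frame set
  have hEq : {y : ↥(archLocal L 2 (Matrix.of fun i j : Fin 2 => if i.val + j.val + 1 = 2 then (1 : L) else 0) w) | ∃ c ∈ K, y * endoBlock L S c w * y⁻¹ ∈ C} =
      e '' {g : ↥(archLocal L 2 (Matrix.diagonal ![(2 : L), -2]) w) |
        ∃ z ∈ (fun c : {w : InfinitePlace L // IsComplex w} → Fin 3 → ℝ => ![Circle.exp (c w 0), Circle.exp (c w 2)]) '' K,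
          g * ⟨circleDiagonal 2 z, circleDiagonal_mem_archLocal_diagonal L 2 ![(2 : L), -2] w z⟩ * g⁻¹ ∈ e ⁻¹' C} := by
    ext y
    simp only [Set.mem_setOf_eq, Set.mem_image, Set.mem_preimage]
    constructor
    · rintro ⟨c, hc, hy⟩
      refine ⟨e.symm y, ⟨_, ⟨c, hc, rfl⟩, ?_⟩, e.apply_symm_apply y⟩
      rw [map_mul, map_mul, map_inv, e.apply_symm_apply, heblk c]
      exact hy
    · rintro ⟨g, ⟨_, ⟨c, hc, rfl⟩, hg⟩, rfl⟩
      refine ⟨c, hc, ?_⟩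
      rw [map_mul, map_mul, map_inv, heblk c] at hg
      exact hg
  rw [hEq]
  exact hcpt.image e.continuous

end CompactPlace


/-! ## §3 The places assembly on `A = U(Φ₂)(L⁺ ⊗ ℝ)` -/

section Assembly

variable (L : Type) [Field L] [NumberField L] [IsCMField L] (S : Finset {w : InfinitePlace L // IsComplex w})

omit [NumberField L] [IsCMField L] in
/-- At a COMPACT place the chart with vanishing coordinates is the identity: `endoBlock S 0 w = P · diag(1, 1) · P⁻¹ = 1`. [cite: Rogawski1990, §8.2 p. 122] -/
theorem endoBlock_zero_of_not_mem {w : {w : InfinitePlace L // IsComplex w}} (hw : w ∉ S) :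
    endoBlock L S (fun _ => ![(0 : ℝ), 0, 0]) w = 1 := by
  have hz : (![Circle.exp ((fun _ : {w : InfinitePlace L // IsComplex w} => ![(0 : ℝ), 0, 0]) w 0),
      Circle.exp ((fun _ : {w : InfinitePlace L // IsComplex w} => ![(0 : ℝ), 0, 0]) w 2)] : Fin 2 → Circle) = 1 := by
    funext i
    fin_cases i <;> simp
  unfold endoBlock
  rw [if_neg hw]
  apply Subtype.ext
  show Matrix.GeneralLinearGroup.mkOfDetNeZero !![(1 : ℂ), 1; 1, -1] det_cayleyTwo_ne_zero * circleDiagonal 2 _ *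
      (Matrix.GeneralLinearGroup.mkOfDetNeZero !![(1 : ℂ), 1; 1, -1] det_cayleyTwo_ne_zero)⁻¹ = (1 : GL (Fin 2) ℂ)
  rw [hz, map_one, mul_one, mul_inv_cancel]

omit [IsCMField L] in
/-- **PER PLACE (both kinds): ONE COMPACT `B_w ⊆ U(Φ₂)(ℂ)_w` CONTAINS A CHART TRANSLATE `y · endoBlock S c′ w` (`c′ w = (x′, 0, 0)`) OF EVERY `y` CONJUGATING SOME
`endoBlock S c w`, `c ∈ K ⊆ RegS S` COMPACT, INTO A COMPACT `C`** — §1 at `w ∈ S` (torus translate), §2 at `w ∉ S` (`x′ = 0`, no translate needed).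
[cite: Rogawski1990, §8.3 p. 122; §3.1 p. 19] [cite: Shelstad1979, §4 p. 22] [cite: DeitmarEchterhoff2014, Lemma 9.3.3] -/
theorem exists_isCompact_forall_exists_mul_endoBlock_mem (w : {w : InfinitePlace L // IsComplex w})
    {K : Set ({w : InfinitePlace L // IsComplex w} → Fin 3 → ℝ)} (hK : IsCompact K) (hKS : K ⊆ RegS S)
    {C : Set ↥(archLocal L 2 (Matrix.of fun i j : Fin 2 => if i.val + j.val + 1 = 2 then (1 : L) else 0) w)} (hC : IsCompact C) :
    ∃ B : Set ↥(archLocal L 2 (Matrix.of fun i j : Fin 2 => if i.val + j.val + 1 = 2 then (1 : L) else 0) w), IsCompact B ∧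
      ∀ c ∈ K, ∀ y : ↥(archLocal L 2 (Matrix.of fun i j : Fin 2 => if i.val + j.val + 1 = 2 then (1 : L) else 0) w),
        y * endoBlock L S c w * y⁻¹ ∈ C → ∃ x' : ℝ, y * endoBlock L S (fun _ => ![x', 0, 0]) w ∈ B := by
  by_cases hw : w ∈ S
  · exact exists_isCompact_forall_exists_mul_endoBlock_mem_of_mem L w S hw hK (fun c hc => ((mem_regS_iff S c).1 (hKS hc)).2 w hw) hC
  · refine ⟨_, isCompact_setOf_exists_conj_endoBlock_mem_of_not_mem L w S hw hK (fun c hc => ((mem_regS_iff S c).1 (hKS hc)).1 w hw) hC,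
      fun c hc y hy => ⟨0, ?_⟩⟩
    rw [endoBlock_zero_of_not_mem L S hw, mul_one]
    exact ⟨c, hc, hy⟩

/-- **THE PLACES ASSEMBLY ON `A = U(Φ₂)(L⁺ ⊗ ℝ) ≅ Π_w U(Φ₂)(ℂ)_w`** (★ `archPiEquivCM`): for compact `K ⊆ RegS S` and compact `C ⊆ A`, ONE compact `B_A := archPiEquivCM⁻¹(Π_w B_w)`
contains a chart translate `y · (endoTorus S c′).1` (`c′ w = (x′_w, 0, 0)`) of every `y ∈ A` conjugating some `(endoTorus S c).1`, `c ∈ K`, into `C` (componentwise: the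
per-place lemma at the `w`-components, ★ `archPiEquivCM_endoTorus_fst`). [cite: Rogawski1990, §4.3 p. 43; §8.3 p. 122] [cite: Folland1995, §2.6 Thm. 2.49]
[cite: DeitmarEchterhoff2014, Lemma 9.3.3] -/
theorem exists_isCompact_forall_exists_mul_endoTorus_fst_mem
    {K : Set ({w : InfinitePlace L // IsComplex w} → Fin 3 → ℝ)} (hK : IsCompact K) (hKS : K ⊆ RegS S)
    {C : Set ↥(arch (↥(maximalRealSubfield L)) L (IsCMField.complexConj L) 2 (Matrix.of fun i j : Fin 2 => if i.val + j.val + 1 = 2 then (1 : L) else 0))}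
    (hC : IsCompact C) :
    ∃ B : Set ↥(arch (↥(maximalRealSubfield L)) L (IsCMField.complexConj L) 2 (Matrix.of fun i j : Fin 2 => if i.val + j.val + 1 = 2 then (1 : L) else 0)),
      IsCompact B ∧ ∀ c ∈ K, ∀ y : ↥(arch (↥(maximalRealSubfield L)) L (IsCMField.complexConj L) 2 (Matrix.of fun i j : Fin 2 => if i.val + j.val + 1 = 2 then (1 : L) else 0)),
        y * (endoTorus L S c).1 * y⁻¹ ∈ C → ∃ x' : {w : InfinitePlace L // IsComplex w} → ℝ, y * (endoTorus L S (fun w => ![x' w, 0, 0])).1 ∈ B := by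
  -- per-place compacts `C_w := pr_w (e C)` and the per-place compact sets `B_w`
  have hCw : ∀ w : {w : InfinitePlace L // IsComplex w}, IsCompact ((fun u : (∀ w' : {w : InfinitePlace L // IsComplex w},
      ↥(archLocal L 2 (Matrix.of fun i j : Fin 2 => if i.val + j.val + 1 = 2 then (1 : L) else 0) w')) => u w) ''
        (archPiEquivCM 2 L (Matrix.of fun i j : Fin 2 => if i.val + j.val + 1 = 2 then (1 : L) else 0) '' C)) := fun w =>
    (hC.image (archPiEquivCM 2 L (Matrix.of fun i j : Fin 2 => if i.val + j.val + 1 = 2 then (1 : L) else 0)).continuous).image (continuous_apply w)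
  choose B hBc hBp using fun w => exists_isCompact_forall_exists_mul_endoBlock_mem L S w hK hKS (hCw w)
  refine ⟨archPiEquivCM 2 L (Matrix.of fun i j : Fin 2 => if i.val + j.val + 1 = 2 then (1 : L) else 0) ⁻¹' Set.pi Set.univ B,
    (archPiEquivCM 2 L (Matrix.of fun i j : Fin 2 => if i.val + j.val + 1 = 2 then (1 : L) else 0)).toHomeomorph.isCompact_preimage.2 (isCompact_univ_pi hBc),
    fun c hc y hy => ?_⟩
  -- the per-place hypotheses at the components of `y`
  have hyw : ∀ w : {w : InfinitePlace L // IsComplex w},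
      archPiEquivCM 2 L (Matrix.of fun i j : Fin 2 => if i.val + j.val + 1 = 2 then (1 : L) else 0) y w * endoBlock L S c w *
          (archPiEquivCM 2 L (Matrix.of fun i j : Fin 2 => if i.val + j.val + 1 = 2 then (1 : L) else 0) y w)⁻¹ ∈
        (fun u : (∀ w' : {w : InfinitePlace L // IsComplex w}, ↥(archLocal L 2 (Matrix.of fun i j : Fin 2 => if i.val + j.val + 1 = 2 then (1 : L) else 0) w')) => u w) ''
          (archPiEquivCM 2 L (Matrix.of fun i j : Fin 2 => if i.val + j.val + 1 = 2 then (1 : L) else 0) '' C) := by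
    intro w
    refine ⟨archPiEquivCM 2 L (Matrix.of fun i j : Fin 2 => if i.val + j.val + 1 = 2 then (1 : L) else 0) (y * (endoTorus L S c).1 * y⁻¹), ⟨_, hy, rfl⟩, ?_⟩
    rw [map_mul, map_mul, map_inv]
    dsimp only
    rw [Pi.mul_apply, Pi.mul_apply, Pi.inv_apply, archPiEquivCM_endoTorus_fst]
  choose x hx using fun w => hBp w c hc _ (hyw w)
  refine ⟨x, ?_⟩
  rw [Set.mem_preimage, Set.mem_univ_pi]
  intro w
  rw [map_mul, Pi.mul_apply, archPiEquivCM_endoTorus_fst]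
  exact hx w

end Assembly

/-! ## §4 (HYP) modulo the chart torus `T_S` on `H_∞`, and the head -/

section Head

variable (L : Type) [Field L] [NumberField L] [IsCMField L] (S : Finset {w : InfinitePlace L // IsComplex w})

/-- `U(Φ₁)(L⁺ ⊗ ℝ) ≅ Π_w U(1)` is compact (`σ_w Φ₁ = (1)` is definite; ★ `isCompact_arch_cm`) — a local copy of ★ `compactSpace_archOne` to keep the imports light.
[cite: Rogawski1990, §4.9 p. 54] [cite: PlatonovRapinchuk1994, §3.2 Thm 3.1] -/
theorem isCompact_univ_archOne :
    IsCompact (Set.univ : Set ↥(arch (↥(maximalRealSubfield L)) L (IsCMField.complexConj L) 1 (Matrix.of fun i j : Fin 1 => if i.val + j.val + 1 = 1 then (1 : L) else 0))) := by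
  open scoped ComplexOrder in
  refine isCompact_iff_isCompact_univ.mp (isCompact_arch_cm (L := L) (N := 1)
    (H := (Matrix.of fun i j : Fin 1 => if i.val + j.val + 1 = 1 then (1 : L) else 0)) fun w => Or.inl ?_)
  rw [antidiagOne_map, Matrix.diagonal_one]
  exact Matrix.PosDef.one

/-- **(HYP) — THE CHART `c ↦ endoTorus S c` OF `H_∞` IS UNIFORMLY PROPER MODULO THE CHART TORUS `T_S` ON `RegS S`**: for compact `K ⊆ RegS S` and compact `C ⊆ H_∞` the
cosets `y T_S` with `y · endoTorus S c · y⁻¹ ∈ C` for some `c ∈ K` lie in ONE compact `𝒦 ⊆ H_∞ ⧸ T_S` — `𝒦 := (B_A × U(Φ₁)_∞) T_S` with `B_A` of §3 for `pr_A C`: the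
chart translate `y · endoTorus S c′` (`c′ w = (x′_w, 0, 0)`, so its `U(Φ₁)`-component is `1`... up to the compact factor, which is absorbed by `U(Φ₁)_∞` itself) lies in
`B_A × U(Φ₁)_∞`, and `endoTorus S c′ ∈ T_S` (★ `endoTorus_mem_chartTorusH`).  The (HYP) binder of ★ `continuousOn_integral_descConj_of_uniformlyProper`.
[cite: Rogawski1990, §8.3 p. 122; §4.9 p. 54] [cite: Shelstad1979, §4 p. 22] [cite: DeitmarEchterhoff2014, Lemma 9.3.3] [cite: Folland1995, §2.6 Thm. 2.49] -/
theorem uniformlyProper_endoTorus :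
    ∀ K ⊆ RegS S, IsCompact K →
      ∀ C : Set (↥(arch (↥(maximalRealSubfield L)) L (IsCMField.complexConj L) 2 (Matrix.of fun i j : Fin 2 => if i.val + j.val + 1 = 2 then (1 : L) else 0)) ×
          ↥(arch (↥(maximalRealSubfield L)) L (IsCMField.complexConj L) 1 (Matrix.of fun i j : Fin 1 => if i.val + j.val + 1 = 1 then (1 : L) else 0))), IsCompact C →
        ∃ 𝒦 : Set ((↥(arch (↥(maximalRealSubfield L)) L (IsCMField.complexConj L) 2 (Matrix.of fun i j : Fin 2 => if i.val + j.val + 1 = 2 then (1 : L) else 0)) ×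
            ↥(arch (↥(maximalRealSubfield L)) L (IsCMField.complexConj L) 1 (Matrix.of fun i j : Fin 1 => if i.val + j.val + 1 = 1 then (1 : L) else 0))) ⧸ chartTorusH L S),
          IsCompact 𝒦 ∧ ∀ c ∈ K, ∀ y : ↥(arch (↥(maximalRealSubfield L)) L (IsCMField.complexConj L) 2 (Matrix.of fun i j : Fin 2 => if i.val + j.val + 1 = 2 then (1 : L) else 0)) ×
              ↥(arch (↥(maximalRealSubfield L)) L (IsCMField.complexConj L) 1 (Matrix.of fun i j : Fin 1 => if i.val + j.val + 1 = 1 then (1 : L) else 0)),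
            y * endoTorus L S c * y⁻¹ ∈ C → (QuotientGroup.mk y : _ ⧸ chartTorusH L S) ∈ 𝒦 := by
  intro K hKS hK C hC
  obtain ⟨B, hB, hmem⟩ := exists_isCompact_forall_exists_mul_endoTorus_fst_mem L S hK hKS (hC.image continuous_fst)
  refine ⟨QuotientGroup.mk '' (B ×ˢ Set.univ), (hB.prod (isCompact_univ_archOne L)).image continuous_quotient_mk', fun c hc y hy => ?_⟩
  obtain ⟨x, hx⟩ := hmem c hc y.1 ⟨_, hy, rfl⟩
  refine ⟨y * endoTorus L S (fun w => ![x w, 0, 0]), ⟨hx, Set.mem_univ _⟩, ?_⟩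
  rw [QuotientGroup.eq, _root_.mul_inv_rev, inv_mul_cancel_right]
  exact (chartTorusH L S).inv_mem (endoTorus_mem_chartTorusH L S _)

variable
  [MeasurableSpace (↥(arch (↥(maximalRealSubfield L)) L (IsCMField.complexConj L) 2 (Matrix.of fun i j : Fin 2 => if i.val + j.val + 1 = 2 then (1 : L) else 0)) ×
      ↥(arch (↥(maximalRealSubfield L)) L (IsCMField.complexConj L) 1 (Matrix.of fun i j : Fin 1 => if i.val + j.val + 1 = 1 then (1 : L) else 0)))]
  [BorelSpace (↥(arch (↥(maximalRealSubfield L)) L (IsCMField.complexConj L) 2 (Matrix.of fun i j : Fin 2 => if i.val + j.val + 1 = 2 then (1 : L) else 0)) ×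
      ↥(arch (↥(maximalRealSubfield L)) L (IsCMField.complexConj L) 1 (Matrix.of fun i j : Fin 1 => if i.val + j.val + 1 = 1 then (1 : L) else 0)))]
  (νH : Measure (↥(arch (↥(maximalRealSubfield L)) L (IsCMField.complexConj L) 2 (Matrix.of fun i j : Fin 2 => if i.val + j.val + 1 = 2 then (1 : L) else 0)) ×
      ↥(arch (↥(maximalRealSubfield L)) L (IsCMField.complexConj L) 1 (Matrix.of fun i j : Fin 1 => if i.val + j.val + 1 = 1 then (1 : L) else 0))))
  [IsFiniteMeasureOnCompacts νH] [νH.IsMulRightInvariant]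

/-- **THE HEAD «(W1-cont-H)»: THE CHART ORBITAL FUNCTIONAL `c ↦ chartOrbH νH S fH c` IS CONTINUOUS ON `RegS S`** for every `fH ∈ C_c(H_∞)` and every `νH` finite on compacts and
right invariant, on EVERY Cartan chart `S` (split at `w ∈ S`, compact at `w ∉ S`) — ★ `continuousOn_integral_descConj_of_uniformlyProper` over `uniformlyProper_endoTorus`, the
quotient `H_∞ ⧸ T_S` carrying its Borel σ-algebra and the quotient measure `dνH ∕ dt_S` being finite on compacts (★ `regular_quotientMeasure`); the constant prefactor `dt_S(B_S)` of
(δ3) is harmless.  The (M1)∕(I₁)-C⁰ input of the direct road on MIXED Cartans (the all-compact Cartan in Haar currency is ★ (CONT-H-ell)).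
[cite: Rogawski1990, §8.3 p. 122] [cite: Shelstad1979, §4 pp. 22–23] [cite: DeitmarEchterhoff2014, Lemma 9.3.3; Thm. 1.5.3] -/
theorem continuousOn_chartOrbH_regS
    {fH : ↥(arch (↥(maximalRealSubfield L)) L (IsCMField.complexConj L) 2 (Matrix.of fun i j : Fin 2 => if i.val + j.val + 1 = 2 then (1 : L) else 0)) ×
      ↥(arch (↥(maximalRealSubfield L)) L (IsCMField.complexConj L) 1 (Matrix.of fun i j : Fin 1 => if i.val + j.val + 1 = 1 then (1 : L) else 0)) → ℂ}
    (hfH : Continuous fH) (hfHc : HasCompactSupport fH) :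
    ContinuousOn (chartOrbH L νH S fH) (RegS S) := by
  letI : MeasurableSpace ((↥(arch (↥(maximalRealSubfield L)) L (IsCMField.complexConj L) 2 (Matrix.of fun i j : Fin 2 => if i.val + j.val + 1 = 2 then (1 : L) else 0)) ×
      ↥(arch (↥(maximalRealSubfield L)) L (IsCMField.complexConj L) 1 (Matrix.of fun i j : Fin 1 => if i.val + j.val + 1 = 1 then (1 : L) else 0))) ⧸ chartTorusH L S) := borel _
  haveI : BorelSpace ((↥(arch (↥(maximalRealSubfield L)) L (IsCMField.complexConj L) 2 (Matrix.of fun i j : Fin 2 => if i.val + j.val + 1 = 2 then (1 : L) else 0)) ×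
      ↥(arch (↥(maximalRealSubfield L)) L (IsCMField.complexConj L) 1 (Matrix.of fun i j : Fin 1 => if i.val + j.val + 1 = 1 then (1 : L) else 0))) ⧸ chartTorusH L S) := ⟨rfl⟩
  haveI : IsFiniteMeasureOnCompacts (chartQuotientMeasureH L νH S) := by
    unfold chartQuotientMeasureH
    infer_instance
  have h := continuousOn_integral_descConj_of_uniformlyProper (chartTorusH L S) (continuous_endoTorus L S) (forall_mem_chartTorusH_comm L S)
    (isOpen_regS S) (uniformlyProper_endoTorus L S) (chartQuotientMeasureH L νH S) hfH hfHc
  have hEq : chartOrbH L νH S fH = fun c => ((chartHaarH L S (chartBoxImg L S)).toReal : ℂ) *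
      ∫ q, descConj (endoTorus L S c) (chartTorusH L S) (forall_mem_chartTorusH_comm L S c) fH q ∂(chartQuotientMeasureH L νH S) := by
    funext c
    exact chartOrbH_def L νH S fH c
  rw [hEq]
  exact continuousOn_const.mul h

end Head

end Literature.NumberTheory.Automorphic.UnitaryGroup

end
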